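import Summits.QuantumFields.BalabanUV.T4Continuum.Support.B13AssemblyCoresEndArithmetic
import Summits.QuantumFields.BalabanUV.T4Continuum.Support.B13StepEndInsOpBalaban

/-!
# B13AssemblyCoresEndBalaban — NE5 ∕ U3: THE END OF RECORD WITH (2.14) FACTOR CORES (`B13AssemblyCoresEnd`, p218821), READ AT BAŁABAN's
# TIER-B BACKGROUND — W1 PRODUCED by the row owner's `B13ReadingsRecord` (p224830: THE RECORD FACE `weightedEntrywiseRate_record_balaban_ne3Shape`)
# BY NAME, the arithmetic letters ELIMINATED by `B13AssemblyCoresEndArithmetic` (p219202) BY NAME; per pair of runs ∕ sub-slot ∕ core family, η-UNIFORMLY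

Cell `pub-balaban`, unit `b2b-balaban-t4-ne5-formalise-leaf-08` (NE5 formalisation swarm, LEAF PROVER 08, gen 10; the (2.14)-CORES ROAD lineage:
/2 `B13TermParamGaussianBi` p216594 → /7 `B13TermCoreFamily` → /8 `B13TermCoreMass` → /9 `B13AssemblyCoresEnd` p218821 → /11 `…Restrict` p220771 →
/12 `…RestrictRecord` p221018 → `…Substrate`∕`…SubstrateAmbient`∕`…SubstrateLetters` p222947∕p223493∕p223680; lineage FOLLOWER under typer
`t4/formal/NE5/LEAVES.md` v2.6 CLAIM RULE 1 ∕ 3 ∕ 7 (b): a NEW module APPLYING landed END faces BY NAME; journal INTENT `HOME/CLAIMS.log` l.17648).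
THE CORES-ROAD TWIN of `b2b-balaban-t4-ne5-formalise-leaf-10`'s E1-insOp-road `B13StepEndInsOpBalaban` (p225077, owner RULING R50 «GO on the twin
road») and of `…-leaf-03`'s E9-road `B13StepEnvelopeEndBalaban`.  Imports `B13AssemblyCoresEndArithmetic` (leaf-10-g6's letters-free faces of this
lineage's /9) and `B13StepEndInsOpBalaban` (leaf-10-g8's `sqrt_rate_pos_lt_one` ∕ `c1_balaban_nonneg` BY NAME, and through it the owner's
`B13ReadingsRecord`); edits nothing; defines NO species reading (owner RULING R41: the readings `B13Readings*` are the row owner's).  Summits-side new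
work under the LEAN PLACEMENT RULE (bookkeeping; 0 `def`; 0 cite tags — printed KIND only).  HONEST FRAMING: rung (B)+1 of the FINITE-VOLUME T⁴
continuum programme — NOT infinite volume, NOT a mass gap, NOT the Clay problem, and **NOT A PROOF OF NE5** (NOT PRINTED: the series prints
ε-UNIFORM bounds, never η-RATES; cell GAPS G-t4-U3-1), NOT a proof of NE2 or NE3: every theorem is an IMPLICATION whose wall binders are DISPLAYED
HYPOTHESES asserted nowhere.  HONEST DEPENDENCY (cell line, verbatim): continuum YM on T⁴ ⇐ BetaPertH ∧ nine spine estimates (0/9 proved);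
BetaPertH ⇐ (D1) ∧ (D4) ∧ CAP+tail; G-an2-4 gates asym, D1 and NE2/3/4.

WHAT THIS FILE DOES (compositions BY NAME; no analytic estimate of its own).  On the (2.14)-cores road the END OF RECORD
`B13AssemblyCoresEnd.ne5_of_record_onSub_cores S₀ M hMA hMB 𝔠 E₀ cB` (slots OF RECORD `S₀` over Bałaban's paired-torus carriers `R.carriers`, factor
activities `actOfCores 𝔠` typed on a sub-slot `M ∋` the operator data of record — of record `↥measOp`, R20) carries W1 as the displayed binder
`hwer : WeightedEntrywiseRate S₀.F (assembly S₀).rawAt S₀.rawB W c₁ (k ↦ θ^k)` (row NE2's entry currency).  With the operator datum the SPECIES datum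
`E := Species Ts Ks Is Ωs Ys` and the two slot lines `hSA : S₀.rawA g V k = (rawA₀ g V k).kernel`, `hSB : S₀.rawB g U k = (rawB₀ g U k).kernel`
([dict], displayed; `rfl` at the substrate's `slotsOfRecord`), that binder IS the conclusion of the owner's RECORD FACE
`B13ReadingsRecord.weightedEntrywiseRate_record_balaban_ne3Shape` at `c₁ := √(2B₁·2CpertRec∕(1−ρ′)) + √(2B₂Λ₂CpertRec) + √(2B₃Λ₃CpertRec) + Λ₄Cn + Λ₅Cn`,
`θ := √ρ′`, `ρ′ := max θ_NE3 L⁻¹` — W1 READ AT BAŁABAN's TIER-B MEMBER OF RECORD from node U1b's `NE3Shape (minActReadings d 𝒞 L N dom (ne2Loc …)) Cn θ`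
(OPEN, row NE3), the (3.35)-class `hreg`, `0 ≤ α, β, Cn`, the threshold `α, β ≤ η ≤ etaStar`, the O1 LETTERS of the five species (decay
`hdec∕hdecΦ∕hdecΨ`, op-Lipschitz `hΦ∕hS₂`, `hΨ∕hS₃`, tower readings `ReadsTowerCov∕Delta∕GammaA∕B` through the reading map
`tow : ℕ → (ℕ → ℝ) → R.carriers.BgB → ↥dom`, dominations, `PotQ∕PotRLipschitzReading`, `Λ₂, …, Λ₅ ≥ 0`).  Input rate `Θ := √(max θ L⁻¹)`
(`sqrt_rate_pos_lt_one`: `0 < Θ < 1` from `2 ≤ L` and `NE3Shape.rate_lt_one` — no rate binder; `c1_balaban_nonneg` discharges `hc₁`); W4 displayed AT `Θ`.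
* §1 **`exists_ne5_of_record_onSub_cores_balaban_ne3Shape`** — PER PAIR OF RUNS, per sub-slot, per core family: leaf-10-g6's letters-free face
  `B13AssemblyCoresEndArithmetic.exists_ne5_of_record_onSub_cores` with `hwer` SUPPLIED by the owner's record face and `hc₁ ∕ hθ0 ∕ hθ1` discharged;
  conclusion LITERALLY `∃ C₅, T4OutputRate.NE5 (outA (onSub S₀ M hMA hMB (actOfCores 𝔠)) E₀ cB) (outB (onSub S₀ M hMA hMB (actOfCores 𝔠)) E₀ cB) W κ θ′ C₅`.
* §2 **`uniform_ne5_of_record_onSub_cores_balaban_ne3Shape`** — ONE `C₅` from the SIZES ONLY (`κ, G, EA₀, E₀, cA, cB, r₀, δ′, θ′, ω`, the letters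
  of W1's constant `o, d, L, a, α, β, Cn, a′, B₁, B₂, B₃, Λ₂, …, Λ₅`, U1b's rate letter `θ < 1`) for EVERY pair of runs `R`, measurable potential
  frame `P`, slot package `S₀` (`S₀.D.ω = ω`), sub-slot `M`, label ∕ parameter ∕ fibre types, CORE FAMILY `𝔠`, factor letters `m⋆, mf, bf, N₀f`,
  radius bound `H`, mass weights `a`, radii, admissible data `dom ∕ 𝒞 ∕ N ∕ RgV` in U1b's shape at `(Cn, θ)`, species tables, towers, window —
  leaf-10-g6's `uniform_ne5_of_record_onSub_cores` with W1 supplied per pair of runs; the η-UNIFORMITY is the quantifier order `∃ C₅, ∀ …`.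
So on the (2.14)-cores road, as on the E1-insOp road (p225077 §2), the E9 road and the tower road (`OutputRateTowerArithmetic` §3), the terminal
face displays ONLY `NE3Shape` + class ∕ threshold + O1 letters + slot lines + `TransportReads` + W3 slice budgets ×2 + L05∕L06 + `RawBounded` ×2 +
floor + W4 `InsertionRate` at `Θ` + `TermBudgetLoc a G` + the FACTOR operator letters of the (2.14) cores (`0 < m⋆ ≤ mf`, `0 ≤ wB`, `0 ≤ N₀f`; per
localizing tuple and factor `N` a.e.-s.m. ∕ holomorphic ∕ `≤ N₀f`, `q` jointly a.e.-s.m. ∕ holomorphic ∕ margin `mf‖v‖² − bf ≤ Re q` on the operator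
ball in `↥M` — W2-op RELOCATED to factor level, GAPS G-ne5p1-1′∕1″, NOT PRINTED; [Balaban1988RG2Cluster] (2.14)–(2.18) pp. 15–16 locate the KIND only)
+ the history radius + the per-domain FACTOR-MASS budget `hmaj` ((2.38)–(2.41) KIND) + rooms ∕ signs + the TWO STRICT SIZE INEQUALITIES
`cA(EA₀ + E₀) < 1 − ω`, `ω + G·cA·(1 − ω)∕(1 − ω − cA(EA₀ + E₀)) < θ′` — no `hwer`, no rate binder, no `ρ₀ ∕ k₀ ∕ B`, no chart.
NOT decided here (census): whether Bałaban's constants satisfy the two inequalities (every letter O(1)-symbolic in print; `B13SmallnessCensus.md`);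
0∕12 leaves on Bałaban's concrete objects (O1 = substrate cell); spine 0∕9.  `FlowStep.BetaPertH`, (B), (B^μ) do not occur.  0 sorry; no new axioms.
-/

noncomputable section

open scoped Matrix.Norms.L2Operator
open Metric Set MeasureTheory

namespace Summit.QuantumFields.BalabanUV.T4Continuum.B13AssemblyCoresEndBalaban

open Literature.MathematicalPhysics.QuantumFieldTheory.Balaban1983to89
open Literature.MathematicalPhysics.QuantumFieldTheory.Balaban1983to89.T4OutputRate (DecayBound NE5)
open Literature.MathematicalPhysics.QuantumFieldTheory.Balaban1983to89.B5Prop11Plancherel (Tor fine)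
open Literature.MathematicalPhysics.QuantumFieldTheory.Balaban1983to89.B5G183RateUnitTower (lev lev_neZero)
open Literature.MathematicalPhysics.QuantumFieldTheory.Balaban1983to89.T4EtaRateMin (NE3Shape)
open Summit.QuantumFields.BalabanUV.T4Continuum.B13Carriers (TwoRuns)
open Summit.QuantumFields.BalabanUV.T4Continuum.B13OpDatum (OpDatum Format Species RawSpecies)
open Summit.QuantumFields.BalabanUV.T4Continuum.B13OpDatumJunctions (opOf RawBounded WeightedEntrywiseRate)
open Summit.QuantumFields.BalabanUV.T4Continuum.B13StepTermLabels (TermIdx InnerLabel)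
open Summit.QuantumFields.BalabanUV.T4Continuum.B13InnerData (Bnd)
open Summit.QuantumFields.BalabanUV.T4Continuum.B13HistMeasurable (MeasPotFrame B13HistM)
open Summit.QuantumFields.BalabanUV.T4Continuum.B13TermRep (actMajorant)
open Summit.QuantumFields.BalabanUV.T4Continuum.B13TermParamGaussianBi (BiCore)
open Summit.QuantumFields.BalabanUV.T4Continuum.B13TermCoreFamily (actOfCores factorCores)
open Summit.QuantumFields.BalabanUV.T4Continuum.B13TermCoreMass (factorMass)
open Summit.QuantumFields.BalabanUV.T4Continuum.B13StepOfRecord (Slots assembly step)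
open Summit.QuantumFields.BalabanUV.T4Continuum.B13StepOfRecordSub (onSub outA outB)
open Summit.QuantumFields.BalabanUV.T4Continuum.OutputRateTermwiseLoc (TermBudgetLoc)
open Summit.QuantumFields.BalabanUV.T4Continuum.B13AssemblyCoresEndArithmetic
  (exists_ne5_of_record_onSub_cores uniform_ne5_of_record_onSub_cores)
open Summit.QuantumFields.BalabanUV.T4Continuum.B13StepEndInsOpBalaban (sqrt_rate_pos_lt_one c1_balaban_nonneg)
open Summit.QuantumFields.BalabanUV.T4Continuum.B13ReadingsDecay (ReadsTowerCovA ReadsTowerCovB CovWeightDominatesDist)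
open Summit.QuantumFields.BalabanUV.T4Continuum.B13ReadingsImage
open Summit.QuantumFields.BalabanUV.T4Continuum.B13ReadingsLocal (PotQLipschitzReading PotRLipschitzReading)
open Summit.QuantumFields.BalabanUV.T4Continuum.B13ReadingsAssembly (CpertRec)
open Summit.QuantumFields.BalabanUV.T4Continuum.B13ReadingsRecord (weightedEntrywiseRate_record_balaban_ne3Shape)
open Summit.QuantumFields.BalabanUV.T4Continuum.DecayRateInterpolation (EntryDecay)
open Summit.QuantumFields.BalabanUV.T4Continuum.BalabanAveragedTowerUnit (idx)
open Summit.QuantumFields.BalabanUV.T4Continuum.GaugeTermScalarData (QuT Q1)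
open Summit.QuantumFields.BalabanUV.T4Continuum.RegularSiteTransporters (siteT)
open Summit.QuantumFields.BalabanUV.T4Continuum.RegularBackgroundTower (RegularTransporters)
open Summit.QuantumFields.BalabanUV.T4Continuum.NE2ColourPerturbedLayer (pertCovC)
open Summit.QuantumFields.BalabanUV.T4Continuum.NE2BalabanRoot (balabanPert)
open Summit.QuantumFields.BalabanUV.T4Continuum.NE2BalabanGauge (gaugeSlot liftR)
open Summit.QuantumFields.BalabanUV.T4Continuum.NE2BalabanThreshold (etaStar)
open Summit.QuantumFields.BalabanUV.T4Continuum.NE2FromNE3Carrier (ne2Loc)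
open Summit.QuantumFields.BalabanUV.T4Continuum.MinimalActionRate (minActReadings)

section Balaban

variable {d : ℕ} (L : ℕ) [NeZero L] (Mf : Fin d → ℕ) [hM : ∀ μ, NeZero (Mf μ)] (a : ℝ) (ha : 0 < a)
variable {o : Type*} [Fintype o] [DecidableEq o] {α β Cn a' η θ : ℝ} {Ts Ks Is Ωs Ys m : Type*} [Fintype m] [DecidableEq m]
variable {𝒞 : ℕ → Set (B7Prop1Explicit.Site d → Fin d → (Matrix o o ℂ)ˣ)} {N : ℕ}
  {dom : Set (B7Prop1Explicit.Site d → Fin d → (Matrix o o ℂ)ˣ)}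
  {RgV : (B7Prop1Explicit.Site d → Fin d → (Matrix o o ℂ)ˣ) → ((k : ℕ) → Fin d → (Tor (fine (lev L k) Mf) → Matrix o o ℂ))}

/-! ## §1 Per pair of runs, per sub-slot, per core family: the cores END of record, W1 produced at Bałaban's tier-B background, letters eliminated -/

section Instance

variable {𝔾 : Type} [GaugeGroup 𝔾] {R : TwoRuns 𝔾} {IOp : Type*} {P : MeasPotFrame R.carriers}
  (S₀ : Slots R (Species Ts Ks Is Ωs Ys) IOp (B13HistM P)) (M : Submodule ℂ (OpDatum (Species Ts Ks Is Ωs Ys)))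
  (hMA : ∀ g V k, opOf S₀.F S₀.rawA g V k ∈ M) (hMB : ∀ g U k, opOf S₀.F S₀.rawB g U k ∈ M)
  {𝒴 : R.carriers.Dom → InnerLabel R.carriers.Dom (Bnd R) → Type*} {domY : ∀ Z ℓ, 𝒴 Z ℓ → R.carriers.Dom}
  {PΛ : R.carriers.Dom → InnerLabel R.carriers.Dom (Bnd R) → Type*} {V : R.carriers.Dom → InnerLabel R.carriers.Dom (Bnd R) → Type*}
  [∀ Z ℓ, MeasurableSpace (PΛ Z ℓ)] [∀ Z ℓ, NormedAddCommGroup (V Z ℓ)] [∀ Z ℓ, InnerProductSpace ℝ (V Z ℓ)]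
  [∀ Z ℓ, MeasurableSpace (V Z ℓ)] [∀ Z ℓ, BorelSpace (V Z ℓ)] [∀ Z ℓ, FiniteDimensional ℝ (V Z ℓ)]
  (𝔠 : ∀ Z ℓ, BiCore P (domY Z ℓ) M (PΛ Z ℓ) (V Z ℓ)) (E₀ cB : ℝ)

/-- [folklore] **THE END OF RECORD WITH (2.14) FACTOR CORES, W1 PRODUCED AT BAŁABAN's TIER-B BACKGROUND, ARITHMETIC LETTERS ELIMINATED — PER
PAIR OF RUNS.**  `B13AssemblyCoresEndArithmetic.exists_ne5_of_record_onSub_cores S₀ M hMA hMB 𝔠 E₀ cB` with its W1 binder `hwer` SUPPLIED BY NAME by the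
owner's record face `B13ReadingsRecord.weightedEntrywiseRate_record_balaban_ne3Shape` (slot lines `hSA`∕`hSB`, `NE3Shape`, class, threshold, O1 letters
displayed instead, VERBATIM and in the owner's order) and `hc₁ ∕ hθ0 ∕ hθ1` discharged (`c1_balaban_nonneg`, `sqrt_rate_pos_lt_one … hNE3.rate_lt_one`);
every other binder of the cores END VERBATIM (reading, slice budgets ×2, levels, the record's `RawBounded` ×2 + floor, W4 AT THE INPUT RATE
`√(max θ L⁻¹)`, `TermBudgetLoc a G`, rooms, the FACTOR operator letters of the cores on the record's indexing over operator balls in `↥M`, the history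
radius, the per-domain FACTOR-MASS budget, sizes, `√(max θ L⁻¹) ≤ θ′ ≤ 1`, the two strict size inequalities).  Conclusion LITERALLY
`∃ C₅, T4OutputRate.NE5 (outA (onSub S₀ M hMA hMB (actOfCores 𝔠)) E₀ cB) (outB (onSub S₀ M hMA hMB (actOfCores 𝔠)) E₀ cB) W κ θ′ C₅`.
NOT a proof of NE5 ∕ NE2 ∕ NE3: an implication from displayed binders. -/
theorem exists_ne5_of_record_onSub_cores_balaban_ne3Shape
    {rawA₀ : (ℕ → ℝ) → R.carriers.BgA → ℕ → RawSpecies Ts Ks Is Ωs Ys} {rawB₀ : (ℕ → ℝ) → R.carriers.BgB → ℕ → RawSpecies Ts Ks Is Ωs Ys}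
    (hSA : ∀ g V k, S₀.rawA g V k = (rawA₀ g V k).kernel) (hSB : ∀ g U k, S₀.rawB g U k = (rawB₀ g U k).kernel) (hL : 2 ≤ L) (hd : 1 ≤ d)
    (hreg : ∀ V ∈ dom, RegularTransporters L Mf (liftR L Mf (RgV V)) α β) (hα : 0 ≤ α) (hβ : 0 ≤ β) (hC : 0 ≤ Cn)
    (hNE3 : NE3Shape (minActReadings d 𝒞 L N dom (ne2Loc L Mf fun V => liftR L Mf (RgV V))) Cn θ)
    (ha' : 0 < a') (hαη : α ≤ η) (hβη : β ≤ η) (hη : η ≤ etaStar o d a a')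
    -- the towers over run B's admissible backgrounds of record (the reading map IS the chart into node NE3's admissible data)
    {tow : ℕ → (ℕ → ℝ) → R.carriers.BgB → ↥dom} {W : Set (ℕ → ℝ)}
    -- the covariance species
    {σ : Ts → Ks → idx L Mf 0 × o} {dist₁ : idx L Mf 0 × o → idx L Mf 0 × o → ℝ} {B₁ δ₁ : ℝ}
    (hdec : ∀ V ∈ dom, ∀ k, EntryDecay dist₁
      (pertCovC L Mf a ha (balabanPert L Mf a (liftR L Mf (RgV V)) (gaugeSlot L Mf (RgV V) (QuT L Mf o (siteT L Mf (RgV V))) (Q1 L Mf o) a'))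
        1 k) B₁ δ₁)
    (hcovA : ReadsTowerCovA
      (fun V : ↥dom => pertCovC L Mf a ha
        (balabanPert L Mf a (liftR L Mf (RgV V)) (gaugeSlot L Mf (RgV V) (QuT L Mf o (siteT L Mf (RgV V))) (Q1 L Mf o) a')) 1)
      σ tow (fun g U k => rawA₀ g (R.carriers.transport U) k) W)
    (hcovB : ReadsTowerCovB
      (fun V : ↥dom => pertCovC L Mf a ha
        (balabanPert L Mf a (liftR L Mf (RgV V)) (gaugeSlot L Mf (RgV V) (QuT L Mf o (siteT L Mf (RgV V))) (Q1 L Mf o) a')) 1)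
      σ tow rawB₀ W)
    (hdom₁ : CovWeightDominatesDist S₀.F dist₁ σ (δ₁ / 2))
    -- the `deltaKer` species
    {S₂ : Set (Matrix (idx L Mf 0 × o) (idx L Mf 0 × o) ℂ)} {Φ : Ts → Matrix (idx L Mf 0 × o) (idx L Mf 0 × o) ℂ → Matrix m m ℂ}
    {Λ₂ : ℝ} (hΦ : ∀ t, OpLipschitzOn S₂ (Φ t) Λ₂) (hΛ₂ : 0 ≤ Λ₂)
    (hS₂ : ∀ V ∈ dom, ∀ k, pertCovC L Mf a ha
      (balabanPert L Mf a (liftR L Mf (RgV V)) (gaugeSlot L Mf (RgV V) (QuT L Mf o (siteT L Mf (RgV V))) (Q1 L Mf o) a')) 1 k ∈ S₂)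
    {dist₂ : m → m → ℝ} {B₂ δ₂ : ℝ}
    (hdecΦ : ∀ V ∈ dom, ∀ t k, EntryDecay dist₂ (Φ t (pertCovC L Mf a ha
      (balabanPert L Mf a (liftR L Mf (RgV V)) (gaugeSlot L Mf (RgV V) (QuT L Mf o (siteT L Mf (RgV V))) (Q1 L Mf o) a')) 1 k)) B₂ δ₂)
    {σX : Ts → Is → m}
    (hΔA : ReadsTowerDeltaA (fun (V : ↥dom) t k => Φ t (pertCovC L Mf a ha
      (balabanPert L Mf a (liftR L Mf (RgV V)) (gaugeSlot L Mf (RgV V) (QuT L Mf o (siteT L Mf (RgV V))) (Q1 L Mf o) a')) 1 k))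
      σX tow (fun g U k => rawA₀ g (R.carriers.transport U) k) W)
    (hΔB : ReadsTowerDeltaB (fun (V : ↥dom) t k => Φ t (pertCovC L Mf a ha
      (balabanPert L Mf a (liftR L Mf (RgV V)) (gaugeSlot L Mf (RgV V) (QuT L Mf o (siteT L Mf (RgV V))) (Q1 L Mf o) a')) 1 k))
      σX tow rawB₀ W)
    (hdom₂ : DeltaWeightDominatesDist S₀.F dist₂ σX (δ₂ / 2))
    -- the `gammaConstituent` species
    {S₃ : Set (Matrix (idx L Mf 0 × o) (idx L Mf 0 × o) ℂ)} {Ψ : Ts → Matrix (idx L Mf 0 × o) (idx L Mf 0 × o) ℂ → Matrix m m ℂ}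
    {Λ₃ : ℝ} (hΨ : ∀ t, OpLipschitzOn S₃ (Ψ t) Λ₃) (hΛ₃ : 0 ≤ Λ₃)
    (hS₃ : ∀ V ∈ dom, ∀ k, pertCovC L Mf a ha
      (balabanPert L Mf a (liftR L Mf (RgV V)) (gaugeSlot L Mf (RgV V) (QuT L Mf o (siteT L Mf (RgV V))) (Q1 L Mf o) a')) 1 k ∈ S₃)
    {dist₃ : m → m → ℝ} {B₃ δ₃ : ℝ}
    (hdecΨ : ∀ V ∈ dom, ∀ t k, EntryDecay dist₃ (Ψ t (pertCovC L Mf a ha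
      (balabanPert L Mf a (liftR L Mf (RgV V)) (gaugeSlot L Mf (RgV V) (QuT L Mf o (siteT L Mf (RgV V))) (Q1 L Mf o) a')) 1 k)) B₃ δ₃)
    {σB : Ts → Ks → m}
    (hΓA : ReadsTowerGammaA (fun (V : ↥dom) t k => Ψ t (pertCovC L Mf a ha
      (balabanPert L Mf a (liftR L Mf (RgV V)) (gaugeSlot L Mf (RgV V) (QuT L Mf o (siteT L Mf (RgV V))) (Q1 L Mf o) a')) 1 k))
      σB σX tow (fun g U k => rawA₀ g (R.carriers.transport U) k) W)
    (hΓB : ReadsTowerGammaB (fun (V : ↥dom) t k => Ψ t (pertCovC L Mf a ha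
      (balabanPert L Mf a (liftR L Mf (RgV V)) (gaugeSlot L Mf (RgV V) (QuT L Mf o (siteT L Mf (RgV V))) (Q1 L Mf o) a')) 1 k))
      σB σX tow rawB₀ W)
    (hdom₃ : GammaWeightDominatesDist S₀.F dist₃ σB σX (δ₃ / 2))
    -- the potential species
    {Λ₄ Λ₅ : ℝ} (hΛ₄ : 0 ≤ Λ₄) (hΛ₅ : 0 ≤ Λ₅)
    (hQ : PotQLipschitzReading (minActReadings d 𝒞 L N dom (ne2Loc L Mf fun V => liftR L Mf (RgV V))) S₀.F
      (fun g U k => rawA₀ g (R.carriers.transport U) k) rawB₀ W Λ₄)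
    (hR : PotRLipschitzReading (minActReadings d 𝒞 L N dom (ne2Loc L Mf fun V => liftR L Mf (RgV V))) S₀.F
      (fun g U k => rawA₀ g (R.carriers.transport U) k) rawB₀ W Λ₅)
    -- the rest of the cores END of record, BY NAME from `B13AssemblyCoresEndArithmetic.exists_ne5_of_record_onSub_cores` (W4 at the input rate)
    {ROp RHist R' H : ℕ → ℝ} {aw : ℕ → TermIdx R.carriers.Dom (Bnd R) → R.carriers.Dom → ℝ}
    {N₀f mf bf : R.carriers.Dom → InnerLabel R.carriers.Dom (Bnd R) → ℝ} {mstar κ G EA₀ cA r₀ δ' θ' : ℝ}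
    (hT : (assembly S₀).TransportReads W)
    (hbB : (assembly S₀).SliceBudgetB W κ cB) (hbA : S₀.D.SliceBudget (step S₀ E₀ cB) W κ cA)
    (hdA : DecayBound (outA (onSub S₀ M hMA hMB (actOfCores 𝔠)) E₀ cB) W EA₀ κ)
    (hdB : DecayBound (outB (onSub S₀ M hMA hMB (actOfCores 𝔠)) E₀ cB) W E₀ κ)
    (hRA : RawBounded S₀.F (assembly S₀).rawAt W) (hRB : RawBounded S₀.F S₀.rawB W) (hfl : ∀ k, r₀ ≤ S₀.rOp k)
    (hins : (step S₀ E₀ cB).InsertionRate W κ E₀ δ' (Real.sqrt (max θ ((L : ℝ)⁻¹))))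
    (hbud : TermBudgetLoc aw G) (hOp : ∀ k, S₀.rOp k ≤ ROp k) (hroom : ∀ k, ROp k < R' k)
    (hHist : ∀ k, (assembly S₀).bHist E₀ cB k + S₀.rHist k ≤ RHist k)
    -- the FACTOR operator letters of the (2.14) cores on the record's indexing over operator balls in `↥M`
    (hm : 0 < mstar) (hmf : ∀ Z ℓ, mstar ≤ mf Z ℓ) (hwB : ∀ Z ℓ, 0 ≤ (𝔠 Z ℓ).wB) (hN₀ : ∀ Z ℓ, 0 ≤ N₀f Z ℓ)
    (hNf : ∀ k, ∀ g ∈ W, ∀ (U : R.carriers.BgB) (X : R.carriers.Dom), R.carriers.scale X = k →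
      ∀ i, (assembly S₀).𝒯.Rel k i X → ∀ n : Fin ((assembly S₀).𝒯.len i + 1),
      (∀ op ∈ ball (⟨opOf S₀.F S₀.rawB g U k, hMB g U k⟩ : M) (R' k),
        AEStronglyMeasurable ((factorCores (assembly S₀).𝒯 𝔠 i n).N op) (factorCores (assembly S₀).𝒯 𝔠 i n).lam) ∧
      (∀ p, DifferentiableOn ℂ (fun op => (factorCores (assembly S₀).𝒯 𝔠 i n).N op p)
        (ball (⟨opOf S₀.F S₀.rawB g U k, hMB g U k⟩ : M) (R' k))) ∧
      (∀ op ∈ ball (⟨opOf S₀.F S₀.rawB g U k, hMB g U k⟩ : M) (R' k), ∀ p,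
        ‖(factorCores (assembly S₀).𝒯 𝔠 i n).N op p‖ ≤ N₀f ((assembly S₀).𝒯.poly i n) ((assembly S₀).𝒯.lab i n)))
    (hqf : ∀ k, ∀ g ∈ W, ∀ (U : R.carriers.BgB) (X : R.carriers.Dom), R.carriers.scale X = k →
      ∀ i, (assembly S₀).𝒯.Rel k i X → ∀ n : Fin ((assembly S₀).𝒯.len i + 1),
      (∀ op ∈ ball (⟨opOf S₀.F S₀.rawB g U k, hMB g U k⟩ : M) (R' k),
        AEStronglyMeasurable (Function.uncurry ((factorCores (assembly S₀).𝒯 𝔠 i n).q op))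
          ((factorCores (assembly S₀).𝒯 𝔠 i n).lam.prod volume)) ∧
      (∀ p v, DifferentiableOn ℂ (fun op => (factorCores (assembly S₀).𝒯 𝔠 i n).q op p v)
        (ball (⟨opOf S₀.F S₀.rawB g U k, hMB g U k⟩ : M) (R' k))) ∧
      (∀ op ∈ ball (⟨opOf S₀.F S₀.rawB g U k, hMB g U k⟩ : M) (R' k), ∀ p v,
        mf ((assembly S₀).𝒯.poly i n) ((assembly S₀).𝒯.lab i n) * ‖v‖ ^ 2 - bf ((assembly S₀).𝒯.poly i n) ((assembly S₀).𝒯.lab i n) ≤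
          ((factorCores (assembly S₀).𝒯 𝔠 i n).q op p v).re))
    -- the history radius about the record's history reference, and the per-domain FACTOR-MASS budget
    (hH : ∀ k, ∀ g ∈ W, ∀ U : R.carriers.BgB, ‖(assembly S₀).histRef g U k‖ + RHist k ≤ H k)
    (hmaj : ∀ k, ∀ g ∈ W, ∀ (U : R.carriers.BgB) (X : R.carriers.Dom), R.carriers.scale X = k → ∀ i,
      actMajorant (assembly S₀).𝒯 (assembly S₀).inc (factorMass 𝔠 N₀f bf mstar (H k)) k X i ≤
        aw k i X * Real.exp (-(κ * R.carriers.d X)))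
    -- sizes, the prescribed rate, the two strict size inequalities
    (hE₀ : 0 ≤ E₀) (hG : 0 ≤ G) (hcA : 0 ≤ cA) (hcB : 0 ≤ cB) (hr₀ : 0 < r₀) (hδ' : 0 ≤ δ')
    (hθθ' : Real.sqrt (max θ ((L : ℝ)⁻¹)) ≤ θ') (hθ'1 : θ' ≤ 1) (hω : 0 < S₀.D.ω) (hω1 : S₀.D.ω < 1)
    (hh : cA * (EA₀ + E₀) < 1 - S₀.D.ω)
    (hsmall : S₀.D.ω + G * cA * (1 - S₀.D.ω) / (1 - S₀.D.ω - cA * (EA₀ + E₀)) < θ') :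
    ∃ C₅, NE5 (outA (onSub S₀ M hMA hMB (actOfCores 𝔠)) E₀ cB) (outB (onSub S₀ M hMA hMB (actOfCores 𝔠)) E₀ cB) W κ θ' C₅ :=
  exists_ne5_of_record_onSub_cores S₀ M hMA hMB 𝔠 E₀ cB hT hbB hbA hdA hdB hRA hRB
    (weightedEntrywiseRate_record_balaban_ne3Shape L Mf a ha S₀ hSA hSB hL hd hreg hα hβ hC hNE3 ha' hαη hβη hη hdec hcovA hcovB hdom₁ hΦ
      hΛ₂ hS₂ hdecΦ hΔA hΔB hdom₂ hΨ hΛ₃ hS₃ hdecΨ hΓA hΓB hdom₃ hΛ₄ hΛ₅ hQ hR)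
    hfl hins hbud hOp hroom hHist hm hmf hwB hN₀ hNf hqf hH hmaj hE₀ hG hcA hcB (c1_balaban_nonneg L a hC hΛ₄ hΛ₅) hr₀ hδ'
    (sqrt_rate_pos_lt_one L hL hNE3.rate_lt_one).1 (sqrt_rate_pos_lt_one L hL hNE3.rate_lt_one).2 hθθ' hθ'1 hω hω1 hh hsmall

end Instance

/-! ## §2 η-uniform: ONE constant for every pair of runs, slot package, sub-slot, core family, factor letters, towers and window -/

section Uniform

/-- [folklore] **ONE CONSTANT FOR EVERY PAIR OF RUNS (η-UNIFORMITY) ON THE (2.14)-CORES ROAD, W1 PRODUCED AT BAŁABAN's TIER-B BACKGROUND, LETTERS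
ELIMINATED** — `B13AssemblyCoresEndArithmetic.uniform_ne5_of_record_onSub_cores` with its W1 binder supplied per pair of runs by the owner's record face.
Fix the SIZES (`κ, G, EA₀, E₀, cA, cB, r₀, δ′, θ′, ω`, the letters of W1's constant `o, d, L, a, α, β, Cn, a′, B₁, B₂, B₃, Λ₂, …, Λ₅`, and U1b's
`θ < 1` — here a SIZE, since `C₅` is chosen before the data), subject to `√(max θ L⁻¹) ≤ θ′ ≤ 1` and the TWO STRICT SIZE INEQUALITIES.  Then ONE `C₅`
serves EVERY pair of runs `R : TwoRuns 𝔾`, measurable potential frame `P`, slot package `S₀` (species format `S₀.F`, `S₀.D.ω = ω`), sub-slot `M ∋`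
the data of record, label ∕ parameter ∕ fibre types `𝒴, domY, PΛ, V`, CORE FAMILY `𝔠`, factor letters `m⋆, mf, bf, N₀f`, radius bound `H`, mass
weights `aw`, radii, admissible data `dom ∕ 𝒞 ∕ N ∕ RgV` in the (3.35)-class and in U1b's shape `NE3Shape … Cn θ`, species tables `rawA₀ ∕ rawB₀`
(slot lines), towers `tow` over `R.carriers.BgB`, O1 letters and window: the displayed binders IMPLY
`NE5 (outA (onSub S₀ M hMA hMB (actOfCores 𝔠)) E₀ cB) (outB (onSub S₀ M hMA hMB (actOfCores 𝔠)) E₀ cB) W κ θ′ C₅`.  NOT a proof of NE5 ∕ NE2 ∕ NE3: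
an implication from displayed binders, the quantifier order `∃ C₅, ∀ …` being the point. -/
theorem uniform_ne5_of_record_onSub_cores_balaban_ne3Shape (hL : 2 ≤ L) (hd : 1 ≤ d) (hα : 0 ≤ α) (hβ : 0 ≤ β) (hC : 0 ≤ Cn)
    (ha' : 0 < a') (hαη : α ≤ η) (hβη : β ≤ η) (hη : η ≤ etaStar o d a a') {B₁ B₂ B₃ Λ₂ Λ₃ Λ₄ Λ₅ : ℝ} (hΛ₂ : 0 ≤ Λ₂)
    (hΛ₃ : 0 ≤ Λ₃) (hΛ₄ : 0 ≤ Λ₄) (hΛ₅ : 0 ≤ Λ₅) (hθ1 : θ < 1) {κ G EA₀ E₀ cA cB r₀ δ' θ' ω : ℝ}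
    (hE₀ : 0 ≤ E₀) (hG : 0 ≤ G) (hcA : 0 ≤ cA) (hcB : 0 ≤ cB) (hr₀ : 0 < r₀) (hδ' : 0 ≤ δ')
    (hθθ' : Real.sqrt (max θ ((L : ℝ)⁻¹)) ≤ θ') (hθ'1 : θ' ≤ 1) (hω : 0 < ω) (hω1 : ω < 1)
    (hh : cA * (EA₀ + E₀) < 1 - ω) (hsmall : ω + G * cA * (1 - ω) / (1 - ω - cA * (EA₀ + E₀)) < θ') :
    ∃ C₅ : ℝ, ∀ {𝔾 : Type} [GaugeGroup 𝔾] {R : TwoRuns 𝔾} {IOp : Type*} {P : MeasPotFrame R.carriers}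
      (S₀ : Slots R (Species Ts Ks Is Ωs Ys) IOp (B13HistM P)) (M : Submodule ℂ (OpDatum (Species Ts Ks Is Ωs Ys)))
      (hMA : ∀ g V k, opOf S₀.F S₀.rawA g V k ∈ M) (hMB : ∀ g U k, opOf S₀.F S₀.rawB g U k ∈ M)
      {𝒴 : R.carriers.Dom → InnerLabel R.carriers.Dom (Bnd R) → Type*} {domY : ∀ Z ℓ, 𝒴 Z ℓ → R.carriers.Dom}
      {PΛ : R.carriers.Dom → InnerLabel R.carriers.Dom (Bnd R) → Type*}
      {V : R.carriers.Dom → InnerLabel R.carriers.Dom (Bnd R) → Type*}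
      [∀ Z ℓ, MeasurableSpace (PΛ Z ℓ)] [∀ Z ℓ, NormedAddCommGroup (V Z ℓ)] [∀ Z ℓ, InnerProductSpace ℝ (V Z ℓ)]
      [∀ Z ℓ, MeasurableSpace (V Z ℓ)] [∀ Z ℓ, BorelSpace (V Z ℓ)] [∀ Z ℓ, FiniteDimensional ℝ (V Z ℓ)]
      (𝔠 : ∀ Z ℓ, BiCore P (domY Z ℓ) M (PΛ Z ℓ) (V Z ℓ))
      {𝒞 : ℕ → Set (B7Prop1Explicit.Site d → Fin d → (Matrix o o ℂ)ˣ)} {N : ℕ}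
      {dom : Set (B7Prop1Explicit.Site d → Fin d → (Matrix o o ℂ)ˣ)}
      {RgV : (B7Prop1Explicit.Site d → Fin d → (Matrix o o ℂ)ˣ) → ((k : ℕ) → Fin d → (Tor (fine (lev L k) Mf) → Matrix o o ℂ))}
      {rawA₀ : (ℕ → ℝ) → R.carriers.BgA → ℕ → RawSpecies Ts Ks Is Ωs Ys} {rawB₀ : (ℕ → ℝ) → R.carriers.BgB → ℕ → RawSpecies Ts Ks Is Ωs Ys}
      {tow : ℕ → (ℕ → ℝ) → R.carriers.BgB → ↥dom} {W : Set (ℕ → ℝ)}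
      {σ : Ts → Ks → idx L Mf 0 × o} {dist₁ : idx L Mf 0 × o → idx L Mf 0 × o → ℝ} {δ₁ : ℝ}
      {S₂ : Set (Matrix (idx L Mf 0 × o) (idx L Mf 0 × o) ℂ)} {Φ : Ts → Matrix (idx L Mf 0 × o) (idx L Mf 0 × o) ℂ → Matrix m m ℂ}
      {dist₂ : m → m → ℝ} {δ₂ : ℝ} {σX : Ts → Is → m}
      {S₃ : Set (Matrix (idx L Mf 0 × o) (idx L Mf 0 × o) ℂ)} {Ψ : Ts → Matrix (idx L Mf 0 × o) (idx L Mf 0 × o) ℂ → Matrix m m ℂ}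
      {dist₃ : m → m → ℝ} {δ₃ : ℝ} {σB : Ts → Ks → m}
      {ROp RHist R' H : ℕ → ℝ} {aw : ℕ → TermIdx R.carriers.Dom (Bnd R) → R.carriers.Dom → ℝ}
      {N₀f mf bf : R.carriers.Dom → InnerLabel R.carriers.Dom (Bnd R) → ℝ} {mstar : ℝ},
      S₀.D.ω = ω →
      (∀ V ∈ dom, RegularTransporters L Mf (liftR L Mf (RgV V)) α β) →
      NE3Shape (minActReadings d 𝒞 L N dom (ne2Loc L Mf fun V => liftR L Mf (RgV V))) Cn θ →
      (∀ g V k, S₀.rawA g V k = (rawA₀ g V k).kernel) → (∀ g U k, S₀.rawB g U k = (rawB₀ g U k).kernel) →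
      (∀ V ∈ dom, ∀ k, EntryDecay dist₁
        (pertCovC L Mf a ha (balabanPert L Mf a (liftR L Mf (RgV V)) (gaugeSlot L Mf (RgV V) (QuT L Mf o (siteT L Mf (RgV V))) (Q1 L Mf o) a'))
          1 k) B₁ δ₁) →
      ReadsTowerCovA
        (fun V : ↥dom => pertCovC L Mf a ha
          (balabanPert L Mf a (liftR L Mf (RgV V)) (gaugeSlot L Mf (RgV V) (QuT L Mf o (siteT L Mf (RgV V))) (Q1 L Mf o) a')) 1)
        σ tow (fun g U k => rawA₀ g (R.carriers.transport U) k) W →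
      ReadsTowerCovB
        (fun V : ↥dom => pertCovC L Mf a ha
          (balabanPert L Mf a (liftR L Mf (RgV V)) (gaugeSlot L Mf (RgV V) (QuT L Mf o (siteT L Mf (RgV V))) (Q1 L Mf o) a')) 1)
        σ tow rawB₀ W →
      CovWeightDominatesDist S₀.F dist₁ σ (δ₁ / 2) →
      (∀ t, OpLipschitzOn S₂ (Φ t) Λ₂) →
      (∀ V ∈ dom, ∀ k, pertCovC L Mf a ha
        (balabanPert L Mf a (liftR L Mf (RgV V)) (gaugeSlot L Mf (RgV V) (QuT L Mf o (siteT L Mf (RgV V))) (Q1 L Mf o) a')) 1 k ∈ S₂) →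
      (∀ V ∈ dom, ∀ t k, EntryDecay dist₂ (Φ t (pertCovC L Mf a ha
        (balabanPert L Mf a (liftR L Mf (RgV V)) (gaugeSlot L Mf (RgV V) (QuT L Mf o (siteT L Mf (RgV V))) (Q1 L Mf o) a')) 1 k)) B₂ δ₂) →
      ReadsTowerDeltaA (fun (V : ↥dom) t k => Φ t (pertCovC L Mf a ha
        (balabanPert L Mf a (liftR L Mf (RgV V)) (gaugeSlot L Mf (RgV V) (QuT L Mf o (siteT L Mf (RgV V))) (Q1 L Mf o) a')) 1 k))
        σX tow (fun g U k => rawA₀ g (R.carriers.transport U) k) W →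
      ReadsTowerDeltaB (fun (V : ↥dom) t k => Φ t (pertCovC L Mf a ha
        (balabanPert L Mf a (liftR L Mf (RgV V)) (gaugeSlot L Mf (RgV V) (QuT L Mf o (siteT L Mf (RgV V))) (Q1 L Mf o) a')) 1 k))
        σX tow rawB₀ W →
      DeltaWeightDominatesDist S₀.F dist₂ σX (δ₂ / 2) →
      (∀ t, OpLipschitzOn S₃ (Ψ t) Λ₃) →
      (∀ V ∈ dom, ∀ k, pertCovC L Mf a ha
        (balabanPert L Mf a (liftR L Mf (RgV V)) (gaugeSlot L Mf (RgV V) (QuT L Mf o (siteT L Mf (RgV V))) (Q1 L Mf o) a')) 1 k ∈ S₃) →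
      (∀ V ∈ dom, ∀ t k, EntryDecay dist₃ (Ψ t (pertCovC L Mf a ha
        (balabanPert L Mf a (liftR L Mf (RgV V)) (gaugeSlot L Mf (RgV V) (QuT L Mf o (siteT L Mf (RgV V))) (Q1 L Mf o) a')) 1 k)) B₃ δ₃) →
      ReadsTowerGammaA (fun (V : ↥dom) t k => Ψ t (pertCovC L Mf a ha
        (balabanPert L Mf a (liftR L Mf (RgV V)) (gaugeSlot L Mf (RgV V) (QuT L Mf o (siteT L Mf (RgV V))) (Q1 L Mf o) a')) 1 k))
        σB σX tow (fun g U k => rawA₀ g (R.carriers.transport U) k) W →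
      ReadsTowerGammaB (fun (V : ↥dom) t k => Ψ t (pertCovC L Mf a ha
        (balabanPert L Mf a (liftR L Mf (RgV V)) (gaugeSlot L Mf (RgV V) (QuT L Mf o (siteT L Mf (RgV V))) (Q1 L Mf o) a')) 1 k))
        σB σX tow rawB₀ W →
      GammaWeightDominatesDist S₀.F dist₃ σB σX (δ₃ / 2) →
      PotQLipschitzReading (minActReadings d 𝒞 L N dom (ne2Loc L Mf fun V => liftR L Mf (RgV V))) S₀.F
        (fun g U k => rawA₀ g (R.carriers.transport U) k) rawB₀ W Λ₄ →
      PotRLipschitzReading (minActReadings d 𝒞 L N dom (ne2Loc L Mf fun V => liftR L Mf (RgV V))) S₀.F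
        (fun g U k => rawA₀ g (R.carriers.transport U) k) rawB₀ W Λ₅ →
      (assembly S₀).TransportReads W →
      (assembly S₀).SliceBudgetB W κ cB → S₀.D.SliceBudget (step S₀ E₀ cB) W κ cA →
      DecayBound (outA (onSub S₀ M hMA hMB (actOfCores 𝔠)) E₀ cB) W EA₀ κ →
      DecayBound (outB (onSub S₀ M hMA hMB (actOfCores 𝔠)) E₀ cB) W E₀ κ →
      RawBounded S₀.F (assembly S₀).rawAt W → RawBounded S₀.F S₀.rawB W → (∀ k, r₀ ≤ S₀.rOp k) →
      (step S₀ E₀ cB).InsertionRate W κ E₀ δ' (Real.sqrt (max θ ((L : ℝ)⁻¹))) →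
      TermBudgetLoc aw G → (∀ k, S₀.rOp k ≤ ROp k) → (∀ k, ROp k < R' k) →
      (∀ k, (assembly S₀).bHist E₀ cB k + S₀.rHist k ≤ RHist k) →
      0 < mstar → (∀ Z ℓ, mstar ≤ mf Z ℓ) → (∀ Z ℓ, 0 ≤ (𝔠 Z ℓ).wB) → (∀ Z ℓ, 0 ≤ N₀f Z ℓ) →
      (∀ k, ∀ g ∈ W, ∀ (U : R.carriers.BgB) (X : R.carriers.Dom), R.carriers.scale X = k →
        ∀ i, (assembly S₀).𝒯.Rel k i X → ∀ n : Fin ((assembly S₀).𝒯.len i + 1),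
        (∀ op ∈ ball (⟨opOf S₀.F S₀.rawB g U k, hMB g U k⟩ : M) (R' k),
          AEStronglyMeasurable ((factorCores (assembly S₀).𝒯 𝔠 i n).N op) (factorCores (assembly S₀).𝒯 𝔠 i n).lam) ∧
        (∀ p, DifferentiableOn ℂ (fun op => (factorCores (assembly S₀).𝒯 𝔠 i n).N op p)
          (ball (⟨opOf S₀.F S₀.rawB g U k, hMB g U k⟩ : M) (R' k))) ∧
        (∀ op ∈ ball (⟨opOf S₀.F S₀.rawB g U k, hMB g U k⟩ : M) (R' k), ∀ p,
          ‖(factorCores (assembly S₀).𝒯 𝔠 i n).N op p‖ ≤ N₀f ((assembly S₀).𝒯.poly i n) ((assembly S₀).𝒯.lab i n))) →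
      (∀ k, ∀ g ∈ W, ∀ (U : R.carriers.BgB) (X : R.carriers.Dom), R.carriers.scale X = k →
        ∀ i, (assembly S₀).𝒯.Rel k i X → ∀ n : Fin ((assembly S₀).𝒯.len i + 1),
        (∀ op ∈ ball (⟨opOf S₀.F S₀.rawB g U k, hMB g U k⟩ : M) (R' k),
          AEStronglyMeasurable (Function.uncurry ((factorCores (assembly S₀).𝒯 𝔠 i n).q op))
            ((factorCores (assembly S₀).𝒯 𝔠 i n).lam.prod volume)) ∧
        (∀ p v, DifferentiableOn ℂ (fun op => (factorCores (assembly S₀).𝒯 𝔠 i n).q op p v)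
          (ball (⟨opOf S₀.F S₀.rawB g U k, hMB g U k⟩ : M) (R' k))) ∧
        (∀ op ∈ ball (⟨opOf S₀.F S₀.rawB g U k, hMB g U k⟩ : M) (R' k), ∀ p v,
          mf ((assembly S₀).𝒯.poly i n) ((assembly S₀).𝒯.lab i n) * ‖v‖ ^ 2 -
              bf ((assembly S₀).𝒯.poly i n) ((assembly S₀).𝒯.lab i n) ≤
            ((factorCores (assembly S₀).𝒯 𝔠 i n).q op p v).re)) →
      (∀ k, ∀ g ∈ W, ∀ U : R.carriers.BgB, ‖(assembly S₀).histRef g U k‖ + RHist k ≤ H k) →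
      (∀ k, ∀ g ∈ W, ∀ (U : R.carriers.BgB) (X : R.carriers.Dom), R.carriers.scale X = k → ∀ i,
        actMajorant (assembly S₀).𝒯 (assembly S₀).inc (factorMass 𝔠 N₀f bf mstar (H k)) k X i ≤
          aw k i X * Real.exp (-(κ * R.carriers.d X))) →
      NE5 (outA (onSub S₀ M hMA hMB (actOfCores 𝔠)) E₀ cB) (outB (onSub S₀ M hMA hMB (actOfCores 𝔠)) E₀ cB) W κ θ' C₅ := by
  obtain ⟨hΘ0, hΘ1⟩ := sqrt_rate_pos_lt_one L hL hθ1
  obtain ⟨C₅, hC₅⟩ := uniform_ne5_of_record_onSub_cores (κ := κ)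
    (c₁ := Real.sqrt (2 * B₁ * (2 * CpertRec o d L a α β Cn a' / (1 - max θ ((L : ℝ)⁻¹)))) +
      Real.sqrt (2 * B₂ * (Λ₂ * CpertRec o d L a α β Cn a')) + Real.sqrt (2 * B₃ * (Λ₃ * CpertRec o d L a α β Cn a')) +
      Λ₄ * Cn + Λ₅ * Cn)
    hE₀ hG hcA hcB (c1_balaban_nonneg L a hC hΛ₄ hΛ₅) hr₀ hδ' hΘ0 hΘ1 hθθ' hθ'1 hω hω1 hh hsmall
  refine ⟨C₅, ?_⟩
  intro 𝔾 _ R IOp P S₀ M hMA hMB 𝒴 domY PΛ V _ _ _ _ _ _ 𝔠 𝒞 N dom RgV rawA₀ rawB₀ tow W σ dist₁ δ₁ S₂ Φ dist₂ δ₂ σX S₃ Ψ dist₃ δ₃ σB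
    ROp RHist R' H aw N₀f mf bf mstar hSω hreg hNE3 hSA hSB hdec hcovA hcovB hdom₁ hΦ hS₂ hdecΦ hΔA hΔB hdom₂ hΨ hS₃ hdecΨ hΓA hΓB
    hdom₃ hQ hR hT hbB hbA hdA hdB hRA hRB hfl hins hbud hOp hroom hHist hm hmf hwB hN₀ hNf hqf hH hmaj
  have hwer := weightedEntrywiseRate_record_balaban_ne3Shape L Mf a ha S₀ hSA hSB hL hd hreg hα hβ hC hNE3 ha' hαη hβη hη hdec hcovA hcovB
    hdom₁ hΦ hΛ₂ hS₂ hdecΦ hΔA hΔB hdom₂ hΨ hΛ₃ hS₃ hdecΨ hΓA hΓB hdom₃ hΛ₄ hΛ₅ hQ hR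
  exact hC₅ S₀ M hMA hMB 𝔠 hSω hT hbB hbA hdA hdB hRA hRB hwer hfl hins hbud hOp hroom hHist hm hmf hwB hN₀ hNf hqf hH hmaj

end Uniform

end Balaban

end Summit.QuantumFields.BalabanUV.T4Continuum.B13AssemblyCoresEndBalaban

end
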